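import Literature.NumberTheory.LFunctions.MoebiusWalshTypeIICoreWalsh
import Literature.NumberTheory.LFunctions.MoebiusWalshVanDerCorput
import Mathlib.Algebra.Order.Chebyshev
import HarnessLib

/-!
# The type-II box estimate with the unshifted digit window (`K = 0`) — Bourgain 2013, §2, (2.1)–(2.22)

Topic `Literature/NumberTheory/LFunctions`; proofs-only (theorems, no definition, no named fact).
This file assembles the `K = 0` half of the TYPE-II estimate of J. Bourgain, *Möbius–Walsh
correlation bounds and an estimate of Mauduit and Rivat*, J. Anal. Math. **119** (2013) 147–163
(= arXiv:1109.2784) [Bourgain2013MoebiusWalsh], §2, for the dyadic box sums of the tree's Vaughan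
reduction (`MoebiusWalshVaughan.boxSum T i j α β = ∑_{a ∈ D_i} ∑_{b ∈ D_j} α(a) β(b) w_T(ab)`,
`D_i = [2^i, 2^{i+1})`, `|α|, |β| ≤ 1`, short side `i ≤ j`), out of the tree's proved layers:

1. (2.1)–(2.2): `|boxSum| ≤ ∑_a |∑_b β_b w_T(ab)|`, Cauchy–Schwarz over `a`, and the bilinear
   van der Corput inequality `MoebiusWalsh.vdC_bilinear` with lags `d < L = 2^ρ` (`R = 1`);
2. digit truncation (`MoebiusWalshTypeII.natWalsh_mul_natWalsh_add_eq_window`,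
   `MoebiusWalshTypeII.card_filter_carry_le`): away from the carry exceptions,
   `w_T(a(b+d)) w_T(ab) = w_{T'}(a(b+d)) w_{T'}(ab)` with `T' = T ∩ [0, q)`, `q = i + ρ + 1 + t`,
   and the exceptions cost `2L·2^i (2^j/2^{ρ+t} + 2)(2^{ρ+1} + 1)` in all;
3. Fourier expansion of the differenced product with the geometric-series kernel
   (`MoebiusWalshTypeII.abs_sum_Ico_natWalsh_mul_natWalsh_le`, (2.5)/(2.11));
4. the core count `MoebiusWalshTypeII.typeII_core_zero_walsh` ((2.13)–(2.22)).

The result `boxSum_sq_typeII_zero_le` is stated SQUARED and with the core count left in the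
explicit closed form of `typeII_core_zero` (sup data `η = 2·2^{-c₂|T'|}`, progression data
`P(m) = 2·2^{κ(q-m)}`); `abs_boxSum_typeII_zero_le` is the same after the square root. Choosing
the switch point of the `min` (Bourgain's (2.20)/(2.21)) and summing the geometric series is left
to the user, together with the choice of `ρ, t` — as is the shifted-window half `K ≥ μ - ρ`
((2.23)–(2.27)), which needs Lemma 5 (`MoebiusWalsh.localisedWalsh`).

## References

* J. Bourgain, J. Anal. Math. 119 (2013) 147–163, §2, (2.1)–(2.22). [Bourgain2013MoebiusWalsh]
-/

noncomputable section

open Finset Real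

namespace Literature.NumberTheory.LFunctions.MoebiusWalshTypeII

open Literature.NumberTheory.LFunctions.MoebiusWalshVaughan (natWalsh dyBlock mem_dyBlock boxSum
  abs_natWalsh)
open Literature.NumberTheory.LFunctions.MoebiusWalsh (walshCoeff walshSupExponent walshL1Exponent
  vdC_bilinear)
open Literature.NumberTheory.Sieve.Vinogradov (geomBound geomBound_nonneg)

/-! ### Small facts about the dyadic blocks -/

/-- `|D_i| = 2^i`. [folklore] -/
theorem card_dyBlock (i : ℕ) : (dyBlock i).card = 2 ^ i := by
  rw [dyBlock, Nat.card_Ico, pow_succ]; omega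

/-- `D_j = [2^j, 2^j + 2^j)`. [folklore] -/
theorem dyBlock_eq_Ico_add (j : ℕ) : dyBlock j = Ico (2 ^ j) (2 ^ j + 2 ^ j) := by
  rw [dyBlock, pow_succ]; congr 1; ring

/-! ### The truncated digit set -/

/-- The elements of `T ∩ [0, q)` are `< q`. [folklore] -/
theorem lt_of_mem_filter_window (T : Finset ℕ) (q : ℕ) :
    ∀ x ∈ T.filter (fun j => 0 ≤ j ∧ j < q + 0), x < q := by
  intro x hx
  have := (Finset.mem_filter.1 hx).2
  omega

/-! ### The differenced sum after digit truncation, one lag -/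

/-- **One lag `d`, one `b`: truncation up to the carry exceptions.** For `a ∈ D_i`, `1 ≤ d < 2^ρ`,
with `w = i + ρ + 1` and `T' = T ∩ [0, w + t)`:
`|∑_{a ∈ D_i} w_T(a(b+d)) w_T(ab)| ≤ |∑_{a ∈ D_i} w_{T'}(a(b+d)) w_{T'}(ab)| + 2 #{a ∈ D_i : ⌊ab/2^w⌋ ≡ -1 (2^t)}`.
[cite: Bourgain2013MoebiusWalsh, §2 (truncation after (2.2))] -/
theorem abs_sum_dyBlock_mul_le_trunc (T : Finset ℕ) (i ρ t b : ℕ) {d : ℕ} (hd : d < 2 ^ ρ) :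
    |∑ a ∈ dyBlock i, natWalsh T (a * (b + d)) * natWalsh T (a * b)| ≤
      |∑ a ∈ dyBlock i,
          natWalsh (T.filter fun j => 0 ≤ j ∧ j < (i + ρ + 1) + t) (a * (b + d)) *
            natWalsh (T.filter fun j => 0 ≤ j ∧ j < (i + ρ + 1) + t) (a * b)| +
        2 * ((dyBlock i).filter fun a => (a * b / 2 ^ (i + ρ + 1)) % 2 ^ t = 2 ^ t - 1).card := by
  set T' := T.filter fun j => 0 ≤ j ∧ j < (i + ρ + 1) + t with hT'
  set F : ℕ → ℝ := fun a => natWalsh T (a * (b + d)) * natWalsh T (a * b) with hF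
  set G : ℕ → ℝ := fun a => natWalsh T' (a * (b + d)) * natWalsh T' (a * b) with hG
  set Bad := (dyBlock i).filter fun a => (a * b / 2 ^ (i + ρ + 1)) % 2 ^ t = 2 ^ t - 1 with hBad
  have hFG : ∀ a ∈ dyBlock i, a ∉ Bad → F a = G a := by
    intro a ha hbad
    have hgood : (a * b / 2 ^ (i + ρ + 1)) % 2 ^ t ≠ 2 ^ t - 1 := by
      intro h; exact hbad (Finset.mem_filter.2 ⟨ha, h⟩)
    have ha1 := (mem_dyBlock.1 ha).1
    have ha2 := (mem_dyBlock.1 ha).2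
    have ha0 : 0 < a := lt_of_lt_of_le (Nat.two_pow_pos i) ha1
    have hδ : a * d < 2 ^ (i + ρ + 1) := by
      calc a * d < a * 2 ^ ρ := mul_lt_mul_of_pos_left hd ha0
        _ ≤ 2 ^ (i + 1) * 2 ^ ρ := Nat.mul_le_mul_right _ ha2.le
        _ = 2 ^ (i + ρ + 1) := by rw [← pow_add]; ring_nf
    simp only [hF, hG]
    rw [show a * (b + d) = a * b + a * d by ring]
    exact natWalsh_mul_natWalsh_add_eq_window T (K := 0) (by simp) hδ hgood
  have hdiff : ∀ a ∈ dyBlock i, |F a - G a| ≤ if a ∈ Bad then 2 else 0 := by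
    intro a ha
    split_ifs with hbad
    · calc |F a - G a| ≤ |F a| + |G a| := abs_sub _ _
        _ ≤ 1 + 1 := by
            simp only [hF, hG]
            rw [abs_mul, abs_mul, abs_natWalsh, abs_natWalsh, abs_natWalsh, abs_natWalsh]; norm_num
        _ = 2 := by norm_num
    · rw [hFG a ha hbad, sub_self, abs_zero]
  calc |∑ a ∈ dyBlock i, F a| = |∑ a ∈ dyBlock i, G a + ∑ a ∈ dyBlock i, (F a - G a)| := by
        rw [← Finset.sum_add_distrib]; congr 1; refine Finset.sum_congr rfl fun a _ => by ring
    _ ≤ |∑ a ∈ dyBlock i, G a| + |∑ a ∈ dyBlock i, (F a - G a)| := abs_add_le _ _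
    _ ≤ |∑ a ∈ dyBlock i, G a| + ∑ a ∈ dyBlock i, |F a - G a| :=
        add_le_add le_rfl (Finset.abs_sum_le_sum_abs _ _)
    _ ≤ |∑ a ∈ dyBlock i, G a| + ∑ a ∈ dyBlock i, (if a ∈ Bad then (2 : ℝ) else 0) :=
        add_le_add le_rfl (Finset.sum_le_sum hdiff)
    _ = |∑ a ∈ dyBlock i, G a| + 2 * (Bad.card : ℝ) := by
        rw [Finset.sum_ite_mem, Finset.sum_const, nsmul_eq_mul]
        congr 1
        rw [show dyBlock i ∩ Bad = Bad from Finset.inter_eq_right.2 (Finset.filter_subset _ _)]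
        ring

/-- **The carry exceptions in a whole box** are few: for `i ≤ j`,
`#{(a, b) ∈ D_i × D_j : ⌊ab/2^{i+ρ+1}⌋ ≡ -1 (2^t)} ≤ 2^i (2^j/2^{ρ+t} + 2)(2^{ρ+1} + 1)`
(count `b` for each `a` by `card_filter_carry_le`). [cite: Bourgain2013MoebiusWalsh, §2 (error term after (2.2))] -/
theorem sum_card_filter_carry_le (i j ρ t : ℕ) :
    ∑ b ∈ dyBlock j, ((((dyBlock i).filter fun a => (a * b / 2 ^ (i + ρ + 1)) % 2 ^ t = 2 ^ t - 1).card : ℕ) : ℝ) ≤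
      2 ^ i * (((2 : ℝ) ^ j / 2 ^ (ρ + t) + 2) * (2 ^ (ρ + 1) + 1)) := by
  -- swap the count: pairs `(a, b)` counted by `a`
  have hswap : ∑ b ∈ dyBlock j,
      ((((dyBlock i).filter fun a => (a * b / 2 ^ (i + ρ + 1)) % 2 ^ t = 2 ^ t - 1).card : ℕ) : ℝ) =
      ∑ a ∈ dyBlock i,
      ((((dyBlock j).filter fun b => (a * b / 2 ^ (i + ρ + 1)) % 2 ^ t = 2 ^ t - 1).card : ℕ) : ℝ) := by
    simp only [Finset.card_filter]
    push_cast
    rw [Finset.sum_comm]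
  rw [hswap]
  have hterm : ∀ a ∈ dyBlock i,
      ((((dyBlock j).filter fun b => (a * b / 2 ^ (i + ρ + 1)) % 2 ^ t = 2 ^ t - 1).card : ℕ) : ℝ) ≤
        ((2 : ℝ) ^ j / 2 ^ (ρ + t) + 2) * (2 ^ (ρ + 1) + 1) := by
    intro a ha
    rw [mem_dyBlock] at ha
    have ha0 : 0 < a := lt_of_lt_of_le (Nat.two_pow_pos i) ha.1
    have h := card_filter_carry_le ha0 (i + ρ + 1) t (N₁ := 2 ^ j) (N₂ := 2 ^ (j + 1))
      (Nat.pow_le_pow_right (by norm_num) (Nat.le_succ j))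
    rw [← dyBlock] at h
    refine h.trans ?_
    have haR : (2 : ℝ) ^ i ≤ a := by exact_mod_cast ha.1
    have haR' : (a : ℝ) ≤ 2 ^ (i + 1) := by exact_mod_cast ha.2.le
    have h1 : ((2 : ℝ) ^ (j + 1) - 2 ^ j) * a / 2 ^ (i + ρ + 1 + t) ≤ 2 ^ j / 2 ^ (ρ + t) := by
      rw [show ((2 : ℝ) ^ (j + 1) - 2 ^ j) = 2 ^ j by rw [pow_succ]; ring]
      rw [div_le_div_iff₀ (by positivity) (by positivity)]
      calc (2 : ℝ) ^ j * a * 2 ^ (ρ + t) ≤ 2 ^ j * 2 ^ (i + 1) * 2 ^ (ρ + t) := by gcongr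
        _ = 2 ^ j * 2 ^ (i + ρ + 1 + t) := by rw [mul_assoc, ← pow_add, ← pow_add]; ring_nf
    have h2 : (2 : ℝ) ^ (i + ρ + 1) / a ≤ 2 ^ (ρ + 1) := by
      rw [div_le_iff₀ (by positivity)]
      calc (2 : ℝ) ^ (i + ρ + 1) = 2 ^ (ρ + 1) * 2 ^ i := by rw [← pow_add]; ring_nf
        _ ≤ 2 ^ (ρ + 1) * a := by gcongr
    push_cast at h1 ⊢
    have hA : 0 ≤ ((2 : ℝ) ^ (j + 1) - 2 ^ j) * a / 2 ^ (i + ρ + 1 + t) + 2 := by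
      have : (0 : ℝ) ≤ (2 : ℝ) ^ (j + 1) - 2 ^ j := by rw [pow_succ]; linarith [pow_pos (show (0:ℝ) < 2 by norm_num) j]
      positivity
    exact mul_le_mul (by linarith) (by linarith) (by positivity) (by positivity)
  calc ∑ a ∈ dyBlock i,
        ((((dyBlock j).filter fun b => (a * b / 2 ^ (i + ρ + 1)) % 2 ^ t = 2 ^ t - 1).card : ℕ) : ℝ)
      ≤ ∑ _a ∈ dyBlock i, ((2 : ℝ) ^ j / 2 ^ (ρ + t) + 2) * (2 ^ (ρ + 1) + 1) := Finset.sum_le_sum hterm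
    _ = 2 ^ i * (((2 : ℝ) ^ j / 2 ^ (ρ + t) + 2) * (2 ^ (ρ + 1) + 1)) := by
        rw [Finset.sum_const, card_dyBlock, nsmul_eq_mul]; push_cast; ring

/-! ### The main theorem -/

/-- **Type-II box estimate, unshifted window (`K = 0`), squared form** (Bourgain 2013, §2,
(2.1)–(2.22)). Let `T ⊆ ℕ` be a digit set, `ρ ≤ j` (`L = 2^ρ` lags; the short side is `i`), `t ∈ ℕ`,
`q = i + ρ + 1 + t`, `T' = T ∩ [0, q)`, `A' = T'.attachFin _` (`|A'| = |T'|`), `|α|, |β| ≤ 1`. Then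
`(boxSum T i j α β)² ≤ 2^i · (4·2^j/2^ρ) · [2^{i+j} + ERR + CORE]` with the carry error
`ERR = 2·2^ρ·2^i (2^j/2^{ρ+t} + 2)(2^{ρ+1} + 1)` and `CORE` the right-hand side of
`typeII_core_zero_walsh` for `A'`, `M = 2^i`, `[N₁, N₂) = D_j`, `H = 2^ρ`.
[cite: Bourgain2013MoebiusWalsh, §2 (2.1)–(2.22)] -/
theorem boxSum_sq_typeII_zero_le (T : Finset ℕ) {i j ρ : ℕ} (t : ℕ) (hρj : ρ ≤ j)
    (α β : ℕ → ℝ) (hα : ∀ a, |α a| ≤ 1) (hβ : ∀ b, |β b| ≤ 1) :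
    (boxSum T i j α β) ^ 2 ≤
      2 ^ i * (4 * 2 ^ j / 2 ^ ρ) *
        ((2 : ℝ) ^ i * 2 ^ j +
          2 * 2 ^ ρ * (2 ^ i * ((2 ^ j / 2 ^ (ρ + t) + 2) * (2 ^ (ρ + 1) + 1))) +
          ((2 ^ ρ : ℕ) * (((2 ^ (j + 1) : ℕ) - (2 ^ j : ℕ) : ℝ) *
              (2 * (2 : ℝ) ^ (-(walshSupExponent *
                ((T.filter fun x => 0 ≤ x ∧ x < (i + ρ + 1) + t).attachFin
                  (lt_of_mem_filter_window T ((i + ρ + 1) + t))).card))) ^ 2 *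
              (2 * (2 ^ ρ : ℕ) * (2 : ℝ) ^ i + 2 ^ (i + ρ + 1 + t) *
                (1 + Real.log (2 ^ (i + ρ + 1 + t))))) +
            ∑ h ∈ Ico 1 (2 ^ ρ), ∑ r ∈ range (i + ρ + 1 + t),
              ((((2 ^ (j + 1) : ℕ) : ℝ) - (2 ^ j : ℕ)) + 2 ^ (i + ρ + 1 + t - r)) *
              ((1 + Real.log (2 ^ (i + ρ + 1 + t))) *
                  ((2 * (2 : ℝ) ^ (walshL1Exponent * ((i + ρ + 1 + t - 0 : ℕ) : ℝ))) *
                    (2 * (2 : ℝ) ^ (walshL1Exponent * ((i + ρ + 1 + t - r : ℕ) : ℝ)))) +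
                2 * (min ((2 * (2 : ℝ) ^ (-(walshSupExponent *
                        ((T.filter fun x => 0 ≤ x ∧ x < (i + ρ + 1) + t).attachFin
                          (lt_of_mem_filter_window T ((i + ρ + 1) + t))).card))) ^ 2 *
                          2 ^ (i + ρ + 1 + t - (r - h.factorization 2)) * 2 ^ (i + ρ + 1 + t - r))
                        ((2 * (2 : ℝ) ^ (walshL1Exponent *
                            ((i + ρ + 1 + t - (r - h.factorization 2) : ℕ) : ℝ))) *
                          (2 * (2 : ℝ) ^ (walshL1Exponent * ((i + ρ + 1 + t - r : ℕ) : ℝ)))) *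
                  (2 * ((2 : ℝ) ^ i / 2 ^ (i + ρ + 1 + t - r)) + 2 ^ (r - h.factorization 2) *
                    (1 + Real.log (2 ^ (r - h.factorization 2)))))))) := by
  set q := (i + ρ + 1) + t with hq
  set T' := T.filter fun x => 0 ≤ x ∧ x < (i + ρ + 1) + t with hT'
  have hT'q : ∀ x ∈ T', x < q := lt_of_mem_filter_window T q
  set A' := T'.attachFin hT'q with hA'
  set M : ℕ := 2 ^ i with hM
  set N : ℕ := 2 ^ j with hN
  set L : ℕ := 2 ^ ρ with hL
  have hL0 : 0 < L := Nat.two_pow_pos ρ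
  have hLN : L ≤ N := Nat.pow_le_pow_right (by norm_num) hρj
  have hMR : ((M : ℕ) : ℝ) = (2 : ℝ) ^ i := by rw [hM]; push_cast; ring
  have hNR : ((N : ℕ) : ℝ) = (2 : ℝ) ^ j := by rw [hN]; push_cast; ring
  have hLR : ((L : ℕ) : ℝ) = (2 : ℝ) ^ ρ := by rw [hL]; push_cast; ring
  -- Step 1: drop `α`
  set S : ℕ → ℝ := fun a => ∑ b ∈ dyBlock j, β b * natWalsh T (a * b) with hS
  have h1 : |boxSum T i j α β| ≤ ∑ a ∈ dyBlock i, |S a| := by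
    unfold boxSum
    refine (Finset.abs_sum_le_sum_abs _ _).trans (Finset.sum_le_sum fun a _ => ?_)
    have : ∑ b ∈ dyBlock j, α a * β b * natWalsh T (a * b) = α a * S a := by
      rw [hS]; dsimp only; rw [Finset.mul_sum]
      exact Finset.sum_congr rfl fun b _ => by ring
    rw [this, abs_mul]
    calc |α a| * |S a| ≤ 1 * |S a| := mul_le_mul_of_nonneg_right (hα a) (abs_nonneg _)
      _ = |S a| := one_mul _
  -- Step 2: Cauchy–Schwarz
  have h2 : (∑ a ∈ dyBlock i, |S a|) ^ 2 ≤ M * ∑ a ∈ dyBlock i, (S a) ^ 2 := by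
    have h := sq_sum_le_card_mul_sum_sq (s := dyBlock i) (f := fun a => |S a|)
    rw [card_dyBlock] at h
    simp only [sq_abs] at h
    rw [hM]; exact_mod_cast h
  -- Step 3: van der Corput in `b` with lags `d < L`, `R = 1`
  have h3 : ∑ a ∈ dyBlock i, (S a) ^ 2 ≤
      (2 * ((N : ℝ) + (L - 1 : ℕ) * (1 : ℕ)) / L) *
        ∑ d ∈ range L, ∑ b ∈ Ico N (N + N),
          (if b + d * 1 < N + N then
            |∑ a ∈ dyBlock i, natWalsh T (a * (b + d * 1)) * natWalsh T (a * b)| else 0) := by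
    have hv := vdC_bilinear (fun a b => natWalsh T (a * b)) (β := β) (dyBlock i) (B₀ := N) (N := N)
      (R := 1) (H := L) hL0 (by rw [mul_one]; omega) hβ
    have hD : dyBlock j = Ico N (N + N) := by rw [hN]; exact dyBlock_eq_Ico_add j
    simp only [hS, hD] at hv ⊢
    exact hv
  -- Step 4: the double sum, lag by lag
  set Bad : ℕ → Finset ℕ := fun b =>
    (dyBlock i).filter fun a => (a * b / 2 ^ (i + ρ + 1)) % 2 ^ t = 2 ^ t - 1 with hBad
  set CORE : ℝ := ∑ h ∈ Ico 1 L, ∑ k ∈ range (2 ^ q), ∑ k' ∈ range (2 ^ q),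
      ‖walshCoeff A' ((k : ℝ) / 2 ^ q)‖ * ‖walshCoeff A' ((k' : ℝ) / 2 ^ q)‖ *
        ∑ n ∈ Ico N (N + N), geomBound (M : ℝ) (((k : ℝ) * (n + h) + k' * n) / 2 ^ q) with hCORE
  set ERRb : ℝ := ∑ b ∈ dyBlock j, (((Bad b).card : ℕ) : ℝ) with hERRb
  have h4 : ∑ d ∈ range L, ∑ b ∈ Ico N (N + N),
        (if b + d * 1 < N + N then
          |∑ a ∈ dyBlock i, natWalsh T (a * (b + d * 1)) * natWalsh T (a * b)| else 0) ≤
      (N : ℝ) * M + 2 * L * ERRb + CORE := by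
    have hD : Ico N (N + N) = dyBlock j := by rw [hN]; exact (dyBlock_eq_Ico_add j).symm
    rw [Finset.range_eq_Ico, Finset.sum_eq_sum_Ico_succ_bot hL0]
    -- the lag `d = 0`
    have h0 : ∑ b ∈ Ico N (N + N), (if b + 0 * 1 < N + N then
        |∑ a ∈ dyBlock i, natWalsh T (a * (b + 0 * 1)) * natWalsh T (a * b)| else 0) = (N : ℝ) * M := by
      have : ∀ b ∈ Ico N (N + N), (if b + 0 * 1 < N + N then
          |∑ a ∈ dyBlock i, natWalsh T (a * (b + 0 * 1)) * natWalsh T (a * b)| else 0) = (M : ℝ) := by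
        intro b hb
        rw [Finset.mem_Ico] at hb
        rw [if_pos (by omega)]
        simp only [zero_mul, add_zero]
        rw [Finset.sum_congr rfl fun a _ => natWalsh_mul_self T (a * b), Finset.sum_const, card_dyBlock,
          nsmul_eq_mul, mul_one, hM]
        push_cast
        exact abs_of_nonneg (by positivity)
      rw [Finset.sum_congr rfl this, Finset.sum_const, Nat.card_Ico, nsmul_eq_mul]
      congr 1; congr 1; omega
    rw [h0]
    -- the lags `1 ≤ d < L`
    have hlag : ∀ d ∈ Ico 1 L, ∑ b ∈ Ico N (N + N), (if b + d * 1 < N + N then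
        |∑ a ∈ dyBlock i, natWalsh T (a * (b + d * 1)) * natWalsh T (a * b)| else 0) ≤
        2 * ERRb + ∑ k ∈ range (2 ^ q), ∑ k' ∈ range (2 ^ q),
          ‖walshCoeff A' ((k : ℝ) / 2 ^ q)‖ * ‖walshCoeff A' ((k' : ℝ) / 2 ^ q)‖ *
            ∑ n ∈ Ico N (N + N), geomBound (M : ℝ) (((k : ℝ) * (n + d) + k' * n) / 2 ^ q) := by
      intro d hd
      rw [Finset.mem_Ico] at hd
      have hdL : d < 2 ^ ρ := by rw [← hL]; exact hd.2
      -- pointwise in `b`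
      have hb : ∀ b ∈ Ico N (N + N), (if b + d * 1 < N + N then
          |∑ a ∈ dyBlock i, natWalsh T (a * (b + d * 1)) * natWalsh T (a * b)| else 0) ≤
          2 * (((Bad b).card : ℕ) : ℝ) + ∑ k ∈ range (2 ^ q), ∑ k' ∈ range (2 ^ q),
            ‖walshCoeff A' ((k : ℝ) / 2 ^ q)‖ * ‖walshCoeff A' ((k' : ℝ) / 2 ^ q)‖ *
              geomBound (M : ℝ) (((k : ℝ) * (b + d) + k' * b) / 2 ^ q) := by
        intro b _
        have hmain : |∑ a ∈ dyBlock i, natWalsh T (a * (b + d)) * natWalsh T (a * b)| ≤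
            2 * (((Bad b).card : ℕ) : ℝ) + ∑ k ∈ range (2 ^ q), ∑ k' ∈ range (2 ^ q),
              ‖walshCoeff A' ((k : ℝ) / 2 ^ q)‖ * ‖walshCoeff A' ((k' : ℝ) / 2 ^ q)‖ *
                geomBound (M : ℝ) (((k : ℝ) * (b + d) + k' * b) / 2 ^ q) := by
          have ht := abs_sum_dyBlock_mul_le_trunc T i ρ t b hdL
          have hf := abs_sum_Ico_natWalsh_mul_natWalsh_le T' hT'q b d (2 ^ i) (2 ^ (i + 1))
          have hcast : (((2 ^ (i + 1) - 2 ^ i : ℕ)) : ℝ) = (M : ℝ) := by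
            rw [hM, show 2 ^ (i + 1) - 2 ^ i = 2 ^ i by rw [pow_succ]; omega]
          rw [hcast] at hf
          rw [← dyBlock] at hf
          simp only [hBad]
          linarith
        split_ifs
        · simpa only [mul_one] using hmain
        · have h0 : 0 ≤ ∑ k ∈ range (2 ^ q), ∑ k' ∈ range (2 ^ q),
              ‖walshCoeff A' ((k : ℝ) / 2 ^ q)‖ * ‖walshCoeff A' ((k' : ℝ) / 2 ^ q)‖ *
                geomBound (M : ℝ) (((k : ℝ) * (b + d) + k' * b) / 2 ^ q) :=
            Finset.sum_nonneg fun k _ => Finset.sum_nonneg fun k' _ =>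
              mul_nonneg (mul_nonneg (norm_nonneg _) (norm_nonneg _)) (geomBound_nonneg (by positivity) _)
          positivity
      refine (Finset.sum_le_sum hb).trans (le_of_eq ?_)
      rw [Finset.sum_add_distrib, ← Finset.mul_sum, hERRb, hD]
      congr 1
      -- move the `b`-sum inside
      rw [Finset.sum_comm]
      refine Finset.sum_congr rfl fun k _ => ?_
      rw [Finset.sum_comm]
      refine Finset.sum_congr rfl fun k' _ => ?_
      rw [Finset.mul_sum, ← hD]
    calc (N : ℝ) * M + ∑ d ∈ Ico 1 L, ∑ b ∈ Ico N (N + N), (if b + d * 1 < N + N then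
          |∑ a ∈ dyBlock i, natWalsh T (a * (b + d * 1)) * natWalsh T (a * b)| else 0)
        ≤ (N : ℝ) * M + ∑ d ∈ Ico 1 L, (2 * ERRb + ∑ k ∈ range (2 ^ q), ∑ k' ∈ range (2 ^ q),
          ‖walshCoeff A' ((k : ℝ) / 2 ^ q)‖ * ‖walshCoeff A' ((k' : ℝ) / 2 ^ q)‖ *
            ∑ n ∈ Ico N (N + N), geomBound (M : ℝ) (((k : ℝ) * (n + d) + k' * n) / 2 ^ q)) :=
          add_le_add le_rfl (Finset.sum_le_sum hlag)
      _ = (N : ℝ) * M + ((Ico 1 L).card * (2 * ERRb) + CORE) := by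
          rw [Finset.sum_add_distrib, Finset.sum_const, nsmul_eq_mul, hCORE]
      _ ≤ (N : ℝ) * M + 2 * L * ERRb + CORE := by
          have hE0 : 0 ≤ ERRb := Finset.sum_nonneg fun b _ => Nat.cast_nonneg _
          have hc : ((Ico 1 L).card : ℝ) ≤ L := by
            rw [Nat.card_Ico]; exact_mod_cast Nat.sub_le L 1
          nlinarith
  -- Step 5: the two inputs
  have hERR : ERRb ≤ 2 ^ i * (((2 : ℝ) ^ j / 2 ^ (ρ + t) + 2) * (2 ^ (ρ + 1) + 1)) :=
    sum_card_filter_carry_le i j ρ t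
  have hCOREle := typeII_core_zero_walsh A' (M := (M : ℝ)) (Nat.cast_nonneg M) (N₁ := N) (N₂ := N + N)
    (Nat.le_add_right N N) L
  -- Step 6: assemble
  have hfac : (2 * ((N : ℝ) + (L - 1 : ℕ) * (1 : ℕ)) / L) ≤ 4 * 2 ^ j / 2 ^ ρ := by
    rw [hLR, hNR]
    have hL1 : ((L - 1 : ℕ) : ℝ) ≤ 2 ^ j := by
      have : ((L - 1 : ℕ) : ℝ) ≤ L := by exact_mod_cast Nat.sub_le L 1
      have hLN' : (L : ℝ) ≤ 2 ^ j := by rw [← hNR]; exact_mod_cast hLN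
      linarith
    rw [div_le_div_iff₀ (by positivity) (by positivity)]
    push_cast
    nlinarith [pow_pos (show (0:ℝ) < 2 by norm_num) ρ]
  have hsum0 : 0 ≤ ∑ d ∈ range L, ∑ b ∈ Ico N (N + N),
        (if b + d * 1 < N + N then
          |∑ a ∈ dyBlock i, natWalsh T (a * (b + d * 1)) * natWalsh T (a * b)| else 0) :=
    Finset.sum_nonneg fun d _ => Finset.sum_nonneg fun b _ => by split_ifs <;> positivity
  have hNN : ((N + N : ℕ) : ℝ) - (N : ℕ) = ((2 ^ (j + 1) : ℕ) : ℝ) - (2 ^ j : ℕ) := by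
    rw [hN]; push_cast; ring
  calc (boxSum T i j α β) ^ 2 = |boxSum T i j α β| ^ 2 := (sq_abs _).symm
    _ ≤ (∑ a ∈ dyBlock i, |S a|) ^ 2 := pow_le_pow_left₀ (abs_nonneg _) h1 2
    _ ≤ M * ∑ a ∈ dyBlock i, (S a) ^ 2 := h2
    _ ≤ M * ((2 * ((N : ℝ) + (L - 1 : ℕ) * (1 : ℕ)) / L) *
          ∑ d ∈ range L, ∑ b ∈ Ico N (N + N),
            (if b + d * 1 < N + N then
              |∑ a ∈ dyBlock i, natWalsh T (a * (b + d * 1)) * natWalsh T (a * b)| else 0)) :=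
        mul_le_mul_of_nonneg_left h3 (Nat.cast_nonneg M)
    _ ≤ M * ((4 * 2 ^ j / 2 ^ ρ) * ((N : ℝ) * M + 2 * L * ERRb + CORE)) := by
        refine mul_le_mul_of_nonneg_left ?_ (Nat.cast_nonneg M)
        exact mul_le_mul hfac h4 hsum0 (by positivity)
    _ ≤ _ := by
        rw [hMR, ← mul_assoc]
        refine mul_le_mul_of_nonneg_left ?_ (by positivity)
        rw [hNR, hLR]
        rw [hNN, hMR, hLR, hNR] at hCOREle
        refine add_le_add (add_le_add (le_of_eq (by ring)) ?_) ?_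
        · exact mul_le_mul_of_nonneg_left hERR (by positivity)
        · rw [hCORE, hMR]; exact hCOREle

/-- **Type-II box estimate, `K = 0`** (Bourgain 2013, §2 (2.1)–(2.22)): the square root of
`boxSum_sq_typeII_zero_le` — `|boxSum T i j α β| ≤ √(2^i (4·2^j/2^ρ)(2^{i+j} + ERR + CORE))`.
[cite: Bourgain2013MoebiusWalsh, §2 (2.29)] -/
theorem abs_boxSum_typeII_zero_le (T : Finset ℕ) {i j ρ : ℕ} (t : ℕ) (hρj : ρ ≤ j)
    (α β : ℕ → ℝ) (hα : ∀ a, |α a| ≤ 1) (hβ : ∀ b, |β b| ≤ 1) {X : ℝ}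
    (hX : 2 ^ i * (4 * 2 ^ j / 2 ^ ρ) *
        ((2 : ℝ) ^ i * 2 ^ j +
          2 * 2 ^ ρ * (2 ^ i * ((2 ^ j / 2 ^ (ρ + t) + 2) * (2 ^ (ρ + 1) + 1))) +
          ((2 ^ ρ : ℕ) * (((2 ^ (j + 1) : ℕ) - (2 ^ j : ℕ) : ℝ) *
              (2 * (2 : ℝ) ^ (-(walshSupExponent *
                ((T.filter fun x => 0 ≤ x ∧ x < (i + ρ + 1) + t).attachFin
                  (lt_of_mem_filter_window T ((i + ρ + 1) + t))).card))) ^ 2 *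
              (2 * (2 ^ ρ : ℕ) * (2 : ℝ) ^ i + 2 ^ (i + ρ + 1 + t) *
                (1 + Real.log (2 ^ (i + ρ + 1 + t))))) +
            ∑ h ∈ Ico 1 (2 ^ ρ), ∑ r ∈ range (i + ρ + 1 + t),
              ((((2 ^ (j + 1) : ℕ) : ℝ) - (2 ^ j : ℕ)) + 2 ^ (i + ρ + 1 + t - r)) *
              ((1 + Real.log (2 ^ (i + ρ + 1 + t))) *
                  ((2 * (2 : ℝ) ^ (walshL1Exponent * ((i + ρ + 1 + t - 0 : ℕ) : ℝ))) *
                    (2 * (2 : ℝ) ^ (walshL1Exponent * ((i + ρ + 1 + t - r : ℕ) : ℝ)))) +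
                2 * (min ((2 * (2 : ℝ) ^ (-(walshSupExponent *
                        ((T.filter fun x => 0 ≤ x ∧ x < (i + ρ + 1) + t).attachFin
                          (lt_of_mem_filter_window T ((i + ρ + 1) + t))).card))) ^ 2 *
                          2 ^ (i + ρ + 1 + t - (r - h.factorization 2)) * 2 ^ (i + ρ + 1 + t - r))
                        ((2 * (2 : ℝ) ^ (walshL1Exponent *
                            ((i + ρ + 1 + t - (r - h.factorization 2) : ℕ) : ℝ))) *
                          (2 * (2 : ℝ) ^ (walshL1Exponent * ((i + ρ + 1 + t - r : ℕ) : ℝ)))) *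
                  (2 * ((2 : ℝ) ^ i / 2 ^ (i + ρ + 1 + t - r)) + 2 ^ (r - h.factorization 2) *
                    (1 + Real.log (2 ^ (r - h.factorization 2)))))))) ≤ X ^ 2)
    (hX0 : 0 ≤ X) :
    |boxSum T i j α β| ≤ X := by
  have h := (boxSum_sq_typeII_zero_le T t hρj α β hα hβ).trans hX
  exact abs_le_of_sq_le_sq h hX0

end Literature.NumberTheory.LFunctions.MoebiusWalshTypeII
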